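import Literature.MathematicalPhysics.QuantumFieldTheory.Balaban1983to89.B9Eq3119DeltaPiCarrier

/-!
# `Balaban1983to89.B9Thm311DeltaPrimeA` — T. Bałaban, *Propagators for lattice gauge theories in a background field*, Commun. Math. Phys.
# **99** (1985) 389–434 [Balaban1985BackgroundPropagators] Theorem 3.11 p. 416, clause one, FIRST operator: **`Δ′_a(U) = Δ^η_U + Q′(U)*a′Q′(U)`
# ((3.24) p. 394) IS POSITIVE DEFINITE — for EVERY background with mutually adjoint transporters (every UNITARY `U`; `U ≡ 1` with no
# letter), at the pub-balaban NE9 chain's letters on the periodic lattice**, so that the Green's function `G′(U) = (Δ′_a(U))⁻¹` of (3.25)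
# (`B9Eq3119DeltaPiCarrier.GpOfU … hpos'`) is CONSTRUCTED with its displayed positivity `hpos'` DISCHARGED

statement-level skeleton of published theorems with citation tags; proofs where landed; nothing here is a claim
about the Yang–Mills mass gap

PDF held: `paper:balaban1985-cmp99-background-propagators` (journal page = PDF page + 388), pp. 391, 393–395, 416 read by this seat
(2026-08-21∕22) in the held text layer (p0003, p0005–p0007, p0028).

THE PRINT (verbatim).  p. 394: *«In the above formulas Δ^η_U is the covariant Laplace operator Δ^η_U = D^η*_U D^η_U (3.23). Let us introduce
the operator Δ′_a = Δ′_a(U) = (Δ^η_U + Q′*aQ′)|_{Ω₀}, where Q′*aQ′ is defined by the same quadratic form as in (2.14) … (3.24)»*; pp. 394–395: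
*«Rf = (I − G′Q′*(Q′G′²Q′*)⁻¹Q′G′)f, (3.25) where G′ = G′(U) = (Δ′_a)⁻¹. We do not know yet if the operators in the above formula are well
defined. Assuming some regularity of the configuration U it can be easily shown that the operator Δ′_a is positive. This implies positivity
of the operators G′, Q′G′²Q′*, hence the existence of the operator R.»*; p. 416, Theorem 3.11: *«Under the assumptions of the Theorems
3.1–3.10 (i.e. for M sufficiently large and α₀ sufficiently small) the operators Δ′_a, G′, (Q′G′²Q′*)⁻¹, Δ_a, G are positive definite.
This is obvious for the first three operators»*; p. 393 (3.19): *«(Q′(V)λ)(y) = Σ_{x∈B(y)} L^{−d}R(V(Γ_{y,x}))λ(x)»*; p. 391 (3.3):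
*«(D^η_{U₀}A)(b) = η⁻¹(R(U₀(b))A(b₊) − A(b₋))»*.

WHY THIS FILE (cell context).  `B9Eq3119DeltaPiCarrier` (NE9 leaf seat `…-leaf-01` gen 72, p308383) types print's `π_U = 1 − D_U G′ R(U) D*_U` and
`Δ_π(U) = π_Uᵗ Δ^η(U) π_U` ((3.119)) at the chain's letters and CONSTRUCTS `G′ := greenK (Δ′_a(U)) hpos'` (its §5b `laplacePrimeA`, `GpOfU`)
modulo ONE displayed operator letter, the positivity `hpos' : ∀ x ≠ 0, 0 < re⟪x, Δ′_a(U) x⟫`.  This file PROVES that letter: the quadratic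
form of (3.24) is `‖D_U λ‖² + a′‖Q′(U)λ‖²`, and its kernel clause `D_U λ = 0 ∧ Q′(U)λ = 0 ⇒ λ = 0` is the abstract averaging-kernel
theorem `B9Eq323Ker.kernel_of_flat_of_avgQ` (sub-cell b09, pass 10: flat `λ` + `Q′λ = 0` at every centre ⇒ `λ = 0`, for any block ∕
contour system whose contours are bond chains from the centre ending at the site, whose blocks cover and whose weights have non-zero
block sums) AT the concrete block ∕ contour system of the periodic lattice `B9Eq319QprimeTorus` (NE9 row owner, gen 77:
`isChain_centre_cons_contour`, `getLast_centre_cons_contour`, `centre_mem_blockOf`, `mem_blockOf_blockCoord`) through which the chain's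
`Q′(U)` (`B9Eq326OperatorAssembly.QprimeW`) is defined.  Sub-cell b09's `B9Thm311Lattice` proves the same clause at an abstract real
`PiLp 2` typing with the block system AXIOMATISED (`IsBlockSystem`); here it holds for the chain's complex weighted `L²` letters and
Bałaban's own cubes and contours, with NO «regularity of the configuration U» — only mutually adjoint transporters (unitarity).

WHAT IS PROVED (sorry-free; theorems only; no definition, no `Prop` placeholder, no inequality of the paper beyond this positivity).
* §1 `adTransportW_injective` (the transporters `R(U(b))X = U(b)XU(b)⁻¹` read on the fibre are injective), `stepTransport_adTransportW_injective`;
  **`flat_of_covDerivL2K_eq_zero`** (`D_U λ = 0`, `η ≠ 0` ⇒ `λ` is `B9Eq323Ker.Flat` for the forward-unit-bond relation and the contour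
  transports); **`eq_zero_of_covDerivL2K_of_QprimeW`**: `D_U λ = 0 ∧ Q′(U)λ = 0 ⇒ λ = 0`, EVERY background `U`.
* §2 **`re_inner_laplacePrimeA`**: `re⟪λ, Δ′_a(U)λ⟫ = ‖D_U λ‖² + a′‖Q̃′(U)λ‖²` (mutually adjoint transporters `hRS`; `Q̃′` = `Q′(U)` read into
  the `c₁`-weighted `L²` space of the unit lattice, as in `laplacePrimeA`); **`laplacePrimeA_pos_of_hRS`** — LITERALLY the binder `hpos'` of
  `B9Eq3119DeltaPiCarrier.GpOfU` from `η ≠ 0`, `0 < a′`, `hRS`; **`laplacePrimeA_pos`** — the same at every UNITARY background (`U(b)* = U(b)⁻¹`)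
  under a tracial `τ` and the cell's norming `⟪φ⁻¹X, φ⁻¹Y⟫ = τ(X*Y)` (`hRS := B9Eq310HessianHermitian.adTransportW_adjoint`);
  **`laplacePrimeA_one_pos`** — at `U ≡ 1` with NO letter; **`deltaPiOfU_GpOfU_gaugeMode_of_unitary`** — `B9Eq3119DeltaPiCarrier`'s END
  `Δ_π(U)(D_U λ) = 0` (`λ ∈ N(Q′(U))`) at `G′ := (Δ′_a(U))⁻¹` with `hpos'` DISCHARGED.
* §3 (fold-ins of the leaf seat `…-leaf-01` gen 73's withdrawn independent twin) `laplacePrimeA_GpOfU` ∕ `GpOfU_laplacePrimeA` (`G′(U)` two-sided),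
  **`re_inner_GpOfU_pos`** (Thm 3.11's SECOND operator `G′ > 0`); §4 **`deltaPiCLM_GpOfU_gaugeMode`** — W₇'s carrier-level letter
  `deltaPiCLM … (G′(U)) …` kills the gauge-mode configurations with NO hypothesis on `G′`.
MODEL / DECLARED READINGS.  (M1) exactly the letters of `B9Eq3119DeltaPiCarrier` §5∕§5b (fine torus `TSite d (L·m)`, fibre `W` read in `𝔸`
along `φ`, weights `c₀`, `c₁`, scalar `η⁻¹`, `Q′(U) = QprimeW`, `Δ_U = covLaplaceSiteK`); (M2) WHOLE TORUS: print's `Δ′_a` carries Dirichlet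
conditions on `∂Ω₀` ((3.24) «|_{Ω₀}»); the chain (and `laplacePrimeA`) works on the full periodic lattice, where no boundary is needed — the
averaging-kernel case of `B9Eq323Ker` («no boundary condition is needed»); (M3) «positive definite» READ as `∀ x ≠ 0, 0 < re⟪x, Δ′_a x⟫`
(the `hpos'` shape of `B11Eq103H1Complex.greenK`); NOT here: any uniform lower bound (Theorems 3.1–3.10), `G′`'s positivity as an
operator inequality beyond `re⟪x, G′x⟫ > 0`, `(Q′G′²Q′*)⁻¹`, `Δ_a`, `G` (the last two = the flat half E170–E172 of the row owner + (3.86), untouched).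
HONEST SCOPE.  [folklore]-level finite-dimensional linear algebra over the tree's constructed (3.3)∕(3.19)∕(3.23)∕(3.24) — one displayed
hypothesis of a landed file becomes a theorem; NOT summit progress (cell pub-balaban: NE9 NOT PRINTED ∕ NOT PROVED; spine PROVED 0∕9).
Filed by the pub-balaban NE9 leaf seat `b2b-balaban-t4-ne9-formalise-leaf-02` (gen 53; X-read C-ne9leaf02g53-1 RESULT R-ne9leaf02-g53-1,
OFFER O-ne9leaf02-g53-1); NEW file importing `B9Eq3119DeltaPiCarrier` only; nothing modified.  Net new unproved facts: 0.
-/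

noncomputable section

open scoped InnerProductSpace ComplexConjugate BigOperators

namespace Literature.MathematicalPhysics.QuantumFieldTheory.Balaban1983to89.B9Thm311DeltaPrimeA

open B4Sect5Torus (TSite)
open B9SectCLatticeCarrier (Bond shift)
open B9Eq311L2Pairing (WL2)
open B9Eq319QprimeTorus (fineP stepTransport)
open B9Eq323Ker (Flat covD_eq_zero_iff kernel_of_flat_of_avgQ)
open B9Eq33CovDerivVector (covDeriv covDeriv_apply)
open B11Eq103H1Complex (SiteL2K covDerivL2K covLaplaceSiteK equiv_covDerivL2K inner_covDivL2K_covDerivL2K)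
open B9Eq310HessianOperator (adTransportW adTransportW_apply)
open B9Eq310HessianHermitian (adTransportW_adjoint)
open B9Eq326OperatorAssembly (QprimeW)
open B9Eq3119DeltaPiCarrier (laplacePrimeA GpOfU deltaPiOfU deltaPiOfU_GpOfU_gaugeMode)

/-! ## §1 The kernel clause: `D_U λ = 0 ∧ Q′(U)λ = 0 ⇒ λ = 0` on the periodic lattice, every background -/

section Kernel

variable {d : ℕ} (L : ℕ) [NeZero L] (m : Fin d → ℕ) {𝔸 : Type*} [Ring 𝔸] [Algebra ℂ 𝔸]
  {W : Type*} [NormedAddCommGroup W] [InnerProductSpace ℂ W] (φ : W ≃ₗ[ℂ] 𝔸) {c₀ : ℝ} [Fact (0 < c₀)]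
  (η : ℝ) (U : Bond d (fineP L m) → 𝔸ˣ)

omit [NeZero L] [Fact (0 < c₀)] in
/-- **The transporters `R(U(b))w = φ⁻¹(U(b)·φw·U(b)⁻¹)` read on the fibre are injective** (conjugation by a unit).
[cite: Balaban1985BackgroundPropagators, p.390] -/
theorem adTransportW_injective (b : Bond d (fineP L m)) : Function.Injective (adTransportW φ U b) := by
  intro v v' h
  rw [adTransportW_apply, adTransportW_apply] at h
  have h1 := φ.symm.injective h
  rw [Units.mul_left_inj, Units.mul_right_inj] at h1
  exact φ.injective h1

omit [NeZero L] [Fact (0 < c₀)] in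
/-- … hence every contour-step transport `R(U(⟨x, x′⟩))` (identity off the forward unit bonds) of the concrete system (3.19) is injective —
the `hinj` of `B9Eq323Ker.kernel_of_flat_of_avgQ`. [cite: Balaban1985BackgroundPropagators, (3.19) p.393] -/
theorem stepTransport_adTransportW_injective (x x' : TSite d (fineP L m)) :
    Function.Injective (stepTransport L m (fun b => (adTransportW φ U b).restrictScalars ℝ) x x') := by
  unfold stepTransport
  split_ifs with h
  · exact adTransportW_injective L m φ U _
  · exact fun _ _ h => h

omit [NeZero L] in
/-- **`D_U λ = 0` with `η ≠ 0` ⇒ `λ` is FLAT** ((3.3): `R(U(b))λ(b₊) = λ(b₋)` on every forward unit bond) for the contour system's relation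
`b = a + e_μ` and its transports — the `hflat` of `B9Eq323Ker.kernel_of_flat_of_avgQ`. [cite: Balaban1985BackgroundPropagators, (3.3) p.391, (3.23) p.394] -/
theorem flat_of_covDerivL2K_eq_zero (hη : η ≠ 0) {x : SiteL2K ℂ d (fineP L m) c₀ W}
    (hD : covDerivL2K ℂ c₀ ((η : ℂ))⁻¹ (adTransportW φ U) x = 0) :
    Flat (fun a b : TSite d (fineP L m) => ∃ μ : Fin d, b = shift μ a)
      (stepTransport L m (fun b => (adTransportW φ U b).restrictScalars ℝ)) (WL2.equiv ℂ _ W x) := by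
  have hD' : covDeriv ((η : ℂ))⁻¹ (adTransportW φ U) (WL2.equiv ℂ _ W x) = 0 := by
    rw [← equiv_covDerivL2K, hD, WL2.equiv_zero]
  have hc : ((η : ℂ))⁻¹ ≠ 0 := inv_ne_zero (Complex.ofReal_ne_zero.2 hη)
  have key : ∀ (y : TSite d (fineP L m)) (μ : Fin d),
      adTransportW φ U (y, μ) (WL2.equiv ℂ _ W x (shift μ y)) = WL2.equiv ℂ _ W x y := fun y μ => by
    have hb := congr_fun hD' (y, μ)
    rw [covDeriv_apply, Pi.zero_apply, smul_eq_zero] at hb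
    exact sub_eq_zero.1 (hb.resolve_left hc)
  intro y y' h
  rw [covD_eq_zero_iff]
  unfold stepTransport
  rw [dif_pos h, LinearMap.restrictScalars_apply]
  have k := key y h.choose
  rw [← h.choose_spec] at k
  exact k

/-- **THE KERNEL CLAUSE `D_U λ = 0 ∧ Q′(U)λ = 0 ⇒ λ = 0` on the periodic lattice, for EVERY background `U`** — p. 395 «it can be easily shown
that the operator Δ′_a is positive», the null-space half: `B9Eq323Ker.kernel_of_flat_of_avgQ` AT the concrete blocks `B(y)`, tree contours
`Γ_{y,x}`, centres and weights `L^{−d}` of `B9Eq319QprimeTorus` (contours are forward-unit-bond chains from the centre ending at `x`; every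
site lies in its block; block weight sums are positive; transports injective). [cite: Balaban1985BackgroundPropagators, (3.24)–(3.25) p.394, Thm 3.11 p.416] -/
theorem eq_zero_of_covDerivL2K_of_QprimeW (hη : η ≠ 0) {x : SiteL2K ℂ d (fineP L m) c₀ W}
    (hD : covDerivL2K ℂ c₀ ((η : ℂ))⁻¹ (adTransportW φ U) x = 0) (hQ : QprimeW L m φ U x = 0) : x = 0 := by
  have hker : WL2.equiv ℂ _ W x = 0 := by
    refine kernel_of_flat_of_avgQ (flat_of_covDerivL2K_eq_zero L m φ η U hη hD) (stepTransport_adTransportW_injective L m φ U)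
      (B9Eq319QprimeTorus.weight L m) (B9Eq319QprimeTorus.blockOf L m)
      (fun _ x => B9Eq319QprimeTorus.contour L m x) (B9Eq319QprimeTorus.centre L m) ?_ ?_ ?_ ?_ ?_
    · intro c y hy
      have hc := (B9Eq319QprimeTorus.mem_blockOf_iff L m c y).1 hy
      have h := B9Eq319QprimeTorus.isChain_centre_cons_contour L m y
      rw [hc] at h
      exact h
    · intro c y hy
      have hc := (B9Eq319QprimeTorus.mem_blockOf_iff L m c y).1 hy
      have h := B9Eq319QprimeTorus.getLast_centre_cons_contour L m y
      simp only [hc] at h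
      exact h
    · intro c
      refine (Finset.sum_pos (fun y _ => ?_) ⟨B9Eq319QprimeTorus.centre L m c, B9Eq319QprimeTorus.centre_mem_blockOf L m c⟩).ne'
      unfold B9Eq319QprimeTorus.weight
      have hL : (0 : ℝ) < L := by exact_mod_cast Nat.pos_of_ne_zero (NeZero.ne L)
      positivity
    · exact fun y => ⟨B9Eq319QprimeTorus.blockCoord L m y, B9Eq319QprimeTorus.mem_blockOf_blockCoord L m y⟩
    · intro c
      have h := congr_fun hQ c
      unfold QprimeW at h
      rw [LinearMap.comp_apply, B9Eq319QprimeTorus.QprimeLin_apply] at h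
      exact h
  apply (WL2.equiv ℂ (fun _ : TSite d (fineP L m) => c₀) W).injective
  rw [hker, WL2.equiv_zero]

end Kernel

/-! ## §2 The quadratic form of (3.24) and the positivity of `Δ′_a(U)` -/

section Positivity

variable {d : ℕ} (L : ℕ) [NeZero L] (m : Fin d → ℕ) {𝔸 : Type*} [Ring 𝔸] [Algebra ℂ 𝔸]
  {W : Type*} [NormedAddCommGroup W] [InnerProductSpace ℂ W] [FiniteDimensional ℂ W] (φ : W ≃ₗ[ℂ] 𝔸) {c₀ : ℝ} [Fact (0 < c₀)]
  (η : ℝ) (U : Bond d (fineP L m) → 𝔸ˣ) {c₁ : ℝ} [Fact (0 < c₁)] (a' : ℝ)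

/-- **THE QUADRATIC FORM of (3.24): `re⟪λ, Δ′_a(U)λ⟫ = ‖D_U λ‖² + a′‖Q̃′(U)λ‖²`** for mutually adjoint transporters (`D*_U = D_U†`,
`B11Eq103H1Complex.inner_covDivL2K_covDerivL2K`); `Q̃′(U)` = `Q′(U)` read into the `c₁`-weighted `L²` space of the unit lattice, exactly as in
`B9Eq3119DeltaPiCarrier.laplacePrimeA`. [cite: Balaban1985BackgroundPropagators, (3.23)–(3.24) p.394] -/
theorem re_inner_laplacePrimeA
    (hRS : ∀ (b : Bond d (fineP L m)) (v u : W), ⟪adTransportW φ U b v, u⟫_ℂ = ⟪v, adTransportW φ (fun b => (U b)⁻¹) b u⟫_ℂ)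
    (x : SiteL2K ℂ d (fineP L m) c₀ W) :
    RCLike.re ⟪x, laplacePrimeA L m φ η U a' (c₁ := c₁) x⟫_ℂ =
      ‖covDerivL2K ℂ c₀ ((η : ℂ))⁻¹ (adTransportW φ U) x‖ ^ 2 +
        a' * ‖((WL2.linearEquiv ℂ ℂ (fun _ : TSite d m => c₁)).symm.toLinearMap ∘ₗ QprimeW L m φ U) x‖ ^ 2 := by
  have hc : conj (((η : ℂ))⁻¹) = ((η : ℂ))⁻¹ := by rw [map_inv₀, Complex.conj_ofReal]
  rw [laplacePrimeA, LinearMap.add_apply, inner_add_right, map_add]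
  congr 1
  · rw [covLaplaceSiteK, LinearMap.comp_apply, inner_covDivL2K_covDerivL2K _ hc _ _ hRS]
    norm_cast
  · rw [LinearMap.smul_apply, inner_smul_right, LinearMap.comp_apply, LinearMap.adjoint_inner_right, ← inner_self_eq_norm_sq (𝕜 := ℂ),
      RCLike.re_to_complex, RCLike.re_to_complex, Complex.re_ofReal_mul]

/-- **`Δ′_a(U)` IS POSITIVE DEFINITE** for `η ≠ 0`, `a′ > 0` and mutually adjoint transporters — [B9] Thm 3.11 clause one, first operator;
the conclusion is LITERALLY the displayed binder `hpos'` of `B9Eq3119DeltaPiCarrier.GpOfU`. [cite: Balaban1985BackgroundPropagators, Thm 3.11 p.416, (3.24)–(3.25) p.394] -/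
theorem laplacePrimeA_pos_of_hRS (hη : η ≠ 0) (ha : 0 < a')
    (hRS : ∀ (b : Bond d (fineP L m)) (v u : W), ⟪adTransportW φ U b v, u⟫_ℂ = ⟪v, adTransportW φ (fun b => (U b)⁻¹) b u⟫_ℂ)
    (x : SiteL2K ℂ d (fineP L m) c₀ W) (hx : x ≠ 0) :
    0 < RCLike.re ⟪x, laplacePrimeA L m φ η U a' (c₁ := c₁) x⟫_ℂ := by
  rw [re_inner_laplacePrimeA L m φ η U a' hRS]
  by_cases hD : covDerivL2K ℂ c₀ ((η : ℂ))⁻¹ (adTransportW φ U) x = 0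
  · by_cases hQ : QprimeW L m φ U x = 0
    · exact absurd (eq_zero_of_covDerivL2K_of_QprimeW L m φ η U hη hD hQ) hx
    · have hQ' : ((WL2.linearEquiv ℂ ℂ (fun _ : TSite d m => c₁)).symm.toLinearMap ∘ₗ QprimeW L m φ U) x ≠ 0 := by
        intro h0
        apply hQ
        simpa using congrArg (WL2.linearEquiv ℂ ℂ (fun _ : TSite d m => c₁)) h0
      have : 0 < a' * ‖((WL2.linearEquiv ℂ ℂ (fun _ : TSite d m => c₁)).symm.toLinearMap ∘ₗ QprimeW L m φ U) x‖ ^ 2 :=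
        mul_pos ha (by positivity)
      positivity
  · have : 0 < ‖covDerivL2K ℂ c₀ ((η : ℂ))⁻¹ (adTransportW φ U) x‖ ^ 2 := by positivity
    have : 0 ≤ a' * ‖((WL2.linearEquiv ℂ ℂ (fun _ : TSite d m => c₁)).symm.toLinearMap ∘ₗ QprimeW L m φ U) x‖ ^ 2 :=
      mul_nonneg ha.le (by positivity)
    positivity

/-- **AT THE FLAT BACKGROUND `U ≡ 1`: `Δ′_a(1) > 0` with NO letter** (`R(1) = 1` is trivially self-adjoint) — `η ≠ 0`, `a′ > 0` only.
[cite: Balaban1985BackgroundPropagators, Thm 3.11 p.416, p.395] -/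
theorem laplacePrimeA_one_pos (hη : η ≠ 0) (ha : 0 < a') (x : SiteL2K ℂ d (fineP L m) c₀ W) (hx : x ≠ 0) :
    0 < RCLike.re ⟪x, laplacePrimeA L m φ η (fun _ : Bond d (fineP L m) => (1 : 𝔸ˣ)) a' (c₁ := c₁) x⟫_ℂ := by
  refine laplacePrimeA_pos_of_hRS L m φ η _ a' hη ha (fun b v u => ?_) x hx
  have h1 : ∀ w : W, adTransportW φ (fun _ : Bond d (fineP L m) => (1 : 𝔸ˣ)) b w = w := fun w => by
    rw [adTransportW_apply, Units.val_one, inv_one, Units.val_one, one_mul, mul_one, LinearEquiv.symm_apply_apply]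
  have h2 : ∀ w : W, adTransportW φ (fun b : Bond d (fineP L m) => ((fun _ : Bond d (fineP L m) => (1 : 𝔸ˣ)) b)⁻¹) b w = w :=
    fun w => by
    rw [adTransportW_apply, inv_one, Units.val_one, inv_one, Units.val_one, one_mul, mul_one, LinearEquiv.symm_apply_apply]
  rw [h1, h2]

variable [StarRing 𝔸] [StarModule ℂ 𝔸] (τ : 𝔸 →ₗ[ℂ] ℂ)

omit [StarModule ℂ 𝔸] in
/-- **AT EVERY UNITARY BACKGROUND (`U(b)* = U(b)⁻¹`), with a tracial `τ` and the cell's norming `⟪φ⁻¹X, φ⁻¹Y⟫ = τ(X*Y)`: `Δ′_a(U) > 0`** —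
the three structural letters `B9Eq3119DeltaPiCarrier` already carries (`tpair_hessOp_comm`); `hRS := B9Eq310HessianHermitian.adTransportW_adjoint`.
Print (p. 395) asks «some regularity of the configuration U»; none is needed. [cite: Balaban1985BackgroundPropagators, Thm 3.11 p.416, p.395] -/
theorem laplacePrimeA_pos (hτ₂ : ∀ X Y : 𝔸, τ (X * Y) = τ (Y * X)) (hφ : ∀ X Y : 𝔸, ⟪φ.symm X, φ.symm Y⟫_ℂ = τ (star X * Y))
    (hU : ∀ b, star (U b : 𝔸) = ((U b)⁻¹ : 𝔸ˣ)) (hη : η ≠ 0) (ha : 0 < a') (x : SiteL2K ℂ d (fineP L m) c₀ W) (hx : x ≠ 0) :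
    0 < RCLike.re ⟪x, laplacePrimeA L m φ η U a' (c₁ := c₁) x⟫_ℂ :=
  laplacePrimeA_pos_of_hRS L m φ η U a' hη ha (adTransportW_adjoint φ τ hτ₂ hU hφ) x hx

/-- **`B9Eq3119DeltaPiCarrier`'s END WITH `hpos'` DISCHARGED: at a unitary background, `Δ_π(U)(D_U λ) = 0` for `λ ∈ N(Q′(U))` at print's own
`G′ = (Δ′_a(U))⁻¹`** — from `hτ₂`, `hφ`, `hU`, `η ≠ 0`, `a′ > 0` alone. [cite: Balaban1985BackgroundPropagators, (3.119) p.419, (3.25) p.394, Thm 3.11 p.416] -/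
theorem deltaPiOfU_GpOfU_gaugeMode_of_unitary (hτ₂ : ∀ X Y : 𝔸, τ (X * Y) = τ (Y * X))
    (hφ : ∀ X Y : 𝔸, ⟪φ.symm X, φ.symm Y⟫_ℂ = τ (star X * Y)) (hU : ∀ b, star (U b : 𝔸) = ((U b)⁻¹ : 𝔸ˣ)) (hη : η ≠ 0) (ha : 0 < a')
    {l : SiteL2K ℂ d (fineP L m) c₀ W} (hl : QprimeW L m φ U l = 0) :
    deltaPiOfU L m φ τ η U (GpOfU L m φ η U a' (c₁ := c₁) (laplacePrimeA_pos L m φ η U a' τ hτ₂ hφ hU hη ha))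
      (covDerivL2K ℂ c₀ ((η : ℂ))⁻¹ (adTransportW φ U) l) = 0 :=
  deltaPiOfU_GpOfU_gaugeMode L m φ τ η U a' _ hl

/-! ## §3 Consequences (fold-ins (f1)–(f3) of ne9-leaf-01 g73's withdrawn twin, W-ne9leaf01-g73-1): `G′(U)` two-sided, positive, and W₇'s letter -/

omit [StarModule ℂ 𝔸] in
/-- **(3.25) «G′ = G′(U) = (Δ′_a)⁻¹» IS WELL DEFINED at every unitary background**: `Δ′_a(U) (G′(U) y) = y` with
`G′(U) := GpOfU … (laplacePrimeA_pos …)`. [cite: Balaban1985BackgroundPropagators, (3.25) p.394] -/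
theorem laplacePrimeA_GpOfU (hτ₂ : ∀ X Y : 𝔸, τ (X * Y) = τ (Y * X)) (hφ : ∀ X Y : 𝔸, ⟪φ.symm X, φ.symm Y⟫_ℂ = τ (star X * Y))
    (hU : ∀ b, star (U b : 𝔸) = ((U b)⁻¹ : 𝔸ˣ)) (hη : η ≠ 0) (ha : 0 < a') (y : SiteL2K ℂ d (fineP L m) c₀ W) :
    laplacePrimeA L m φ η U a' (c₁ := c₁) (GpOfU L m φ η U a' (c₁ := c₁) (laplacePrimeA_pos L m φ η U a' τ hτ₂ hφ hU hη ha) y) = y :=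
  B11Eq103H1Complex.apply_greenK _ y

omit [StarModule ℂ 𝔸] in
/-- … and `G′(U) (Δ′_a(U) x) = x`. [cite: Balaban1985BackgroundPropagators, (3.25) p.394] -/
theorem GpOfU_laplacePrimeA (hτ₂ : ∀ X Y : 𝔸, τ (X * Y) = τ (Y * X)) (hφ : ∀ X Y : 𝔸, ⟪φ.symm X, φ.symm Y⟫_ℂ = τ (star X * Y))
    (hU : ∀ b, star (U b : 𝔸) = ((U b)⁻¹ : 𝔸ˣ)) (hη : η ≠ 0) (ha : 0 < a') (x : SiteL2K ℂ d (fineP L m) c₀ W) :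
    GpOfU L m φ η U a' (c₁ := c₁) (laplacePrimeA_pos L m φ η U a' τ hτ₂ hφ hU hη ha) (laplacePrimeA L m φ η U a' (c₁ := c₁) x) = x :=
  B11Eq103H1Complex.greenK_apply _ x

omit [StarModule ℂ 𝔸] in
/-- **Thm 3.11's SECOND operator: «… G′ … positive definite» — `x ≠ 0 ⇒ 0 < re⟪x, G′(U)x⟫`** at every unitary background (p. 395 «This implies
positivity of the operators G′ …»). [cite: Balaban1985BackgroundPropagators, Thm 3.11 p.416, p.395] -/
theorem re_inner_GpOfU_pos (hτ₂ : ∀ X Y : 𝔸, τ (X * Y) = τ (Y * X)) (hφ : ∀ X Y : 𝔸, ⟪φ.symm X, φ.symm Y⟫_ℂ = τ (star X * Y))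
    (hU : ∀ b, star (U b : 𝔸) = ((U b)⁻¹ : 𝔸ˣ)) (hη : η ≠ 0) (ha : 0 < a') (x : SiteL2K ℂ d (fineP L m) c₀ W) (hx : x ≠ 0) :
    0 < RCLike.re ⟪x, GpOfU L m φ η U a' (c₁ := c₁) (laplacePrimeA_pos L m φ η U a' τ hτ₂ hφ hU hη ha) x⟫_ℂ :=
  B11Eq103H1Complex.re_inner_greenK_pos _ x hx

end Positivity

/-! ## §4 W₇'s letter at `G′(U)`: the carrier-level gauge-mode vanishing with NO hypothesis on `G′` -/

section Carrier

open B11Eq103H1Complex (funEquiv)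
open B11Eq115Space (Space115)
open B11Eq90V0primeCurrent (flat115)
open B9Eq3119DeltaPiCarrier (deltaPiCLM deltaPiCLM_gaugeMode GpOfU_gaugeMode)

variable {d : ℕ} (L : ℕ) [NeZero L] (m : Fin d → ℕ) {𝔸 : Type*} [NormedRing 𝔸] [NormedAlgebra ℂ 𝔸] [StarRing 𝔸] [StarModule ℂ 𝔸]
  [FiniteDimensional ℂ 𝔸] {W : Type*} [NormedAddCommGroup W] [InnerProductSpace ℂ W] [FiniteDimensional ℂ W] (φ : W ≃ₗ[ℂ] 𝔸)
  {c₀ : ℝ} [Fact (0 < c₀)] (τ : 𝔸 →ₗ[ℂ] ℂ) {Lr η : ℝ} [Fact (0 < Lr)] [Fact (0 < η)] (U : Bond d (fineP L m) → 𝔸ˣ) {c₁ : ℝ} [Fact (0 < c₁)]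
  (a' : ℝ) {lev₀ : Bond d (fineP L m) → ℕ} {κ' : Type*} [Fintype κ'] (lev₁ : κ' → ℕ) (Dc : (Bond d (fineP L m) → 𝔸) →ₗ[ℂ] (κ' → 𝔸))

/-- **W₇'s LETTER `Δπ := deltaPiCLM … (G′(U)) …` KILLS THE GAUGE-MODE CONFIGURATIONS with NO hypothesis on `G′`**: for `λ ∈ N(Q′(U))` and a
(115)-configuration `Y` whose bond function is `D_U λ`, `Δπ Y = 0` — `B9Eq3119DeltaPiCarrier.deltaPiCLM_gaugeMode` with (g5) AND `hpos'`
discharged (unitary `U`, tracial `τ`, the norming, `0 < a′`; `η > 0` from the carrier).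
[cite: Balaban1985BackgroundPropagators, (3.119) p.419, (3.25) p.394, Thm 3.11 p.416] -/
theorem deltaPiCLM_GpOfU_gaugeMode (hτ₂ : ∀ X Y : 𝔸, τ (X * Y) = τ (Y * X)) (hφ : ∀ X Y : 𝔸, ⟪φ.symm X, φ.symm Y⟫_ℂ = τ (star X * Y))
    (hU : ∀ b, star (U b : 𝔸) = ((U b)⁻¹ : 𝔸ˣ)) (ha : 0 < a') {l : SiteL2K ℂ d (fineP L m) c₀ W} (hl : QprimeW L m φ U l = 0)
    (Y : Space115 Lr η lev₀ lev₁ Dc)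
    (hY : flat115 Y = funEquiv φ (fun _ : Bond d (fineP L m) => c₀) (covDerivL2K ℂ c₀ ((η : ℂ))⁻¹ (adTransportW φ U) l)) :
    deltaPiCLM L m φ τ U (GpOfU L m φ η U a' (c₁ := c₁)
      (laplacePrimeA_pos L m φ η U a' (c₀ := c₀) (c₁ := c₁) τ hτ₂ hφ hU (ne_of_gt Fact.out) ha)) lev₁ Dc Y = 0 :=
  deltaPiCLM_gaugeMode L m φ τ U _ lev₁ Dc (fun l hl => GpOfU_gaugeMode L m φ η U a' _ l hl) hl Y hY

end Carrier

end Literature.MathematicalPhysics.QuantumFieldTheory.Balaban1983to89.B9Thm311DeltaPrimeA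

end
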